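import Literature.NumberTheory.EllipticCurves.KatoTwistedFinitenessIsotypicProofs
import Literature.NumberTheory.EllipticCurves.KatoTwistedFinitenessEulerFactorsProofs
import Literature.NumberTheory.EllipticCurves.KatoTwistedFinitenessDescent
import Literature.NumberTheory.EllipticCurves.RohrlichNonvanishingRankinProofs
import Literature.NumberTheory.EllipticCurves.MordellWeil
import Mathlib.LinearAlgebra.Dimension.Localization
import Mathlib.LinearAlgebra.Dimension.Torsion.Finite
import HarnessLib

/-!
# Kato's Thm. 14.4 (Astérisque 295, p. 236): bounded Mordell–Weil rank in the tower `ℚ(ζ_{m^n})`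

Topic `Literature/NumberTheory/EllipticCurves`; theorems only (no definition, no named fact).

K. Kato, *`p`-adic Hodge theory and values of zeta functions of modular forms*, Astérisque 295
(2004), p. 236, right after Cor. 14.3 (vendored in the tree as the named fact
`kato_finite_chiPart_of_twistedLValue_ne_zero`: `L(E, χ, 1) ≠ 0 ⇒ E(ℚ(ζ_m))^(χ)` finite):

> "I learned from Professor John Coates that the following result is deduced from Cor. 14.3 by
> using the theorem of Rohrlich introduced in 13.5 (2). **Theorem 14.4.** Let `A` be an abelian
> variety over `ℚ` such that there is a surjective homomorphism `J₁(N) → A` for some `N ≥ 1`.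
> Then for any `m ≥ 1`, `∪_n A(ℚ(ζ_{m^n}))` is finitely generated as an abelian group. The
> argument to deduce 14.4 from 14.2 is given in Rohrlich [Ro1, §3]."

Here [Ro1] = D. Rohrlich, Invent. Math. 75 (1984), and Thm. 13.5 (2) (p. 227, quoted from
[Ro2] = Math. Ann. 281 (1988)) is the finiteness of the set of Dirichlet characters `χ` of
`m`-smooth conductor with `L_S(f, χ, k/2) = 0`. In the tree, Rohrlich's 1984 theorem is PROVED
(`Rohrlich1984_nonvanishing_twists_holds`, for sets of primes not dividing the level) and so is
the Mordell–Weil theorem (`WeierstrassCurve.module_finite_point_holds`); this file carries out the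
deduction of the RANK part of Thm. 14.4 for elliptic curves, conditionally on Cor. 14.3 (2) ONLY
(hypothesis `hK : kato_finite_chiPart_of_twistedLValue_ne_zero`, Kato's theorem proper, NOT proved
in the tree):

* `finrank_point_cyclotomic_le_of_kato` — the engine: if every Dirichlet character mod `M`
  failing Kato's hypothesis has conductor dividing `M₀ ∣ M`, then
  `rank E(ℚ(ζ_M)) ≤ #{χ mod M₀} · rank E(ℚ(ζ_{M₀}))` (isotypic exhaustion of `E(ℚ(ζ_M))` by the
  `χ`-parts of Dirichlet characters, `exists_pos_smul_mem_iSup_chiPart_dirichlet`; Kato for the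
  non-exceptional `χ`; Galois descent `mem_range_map_of_mem_chiPart_changeLevel` for the
  exceptional ones, which are inflated from level `M₀`);
* `exists_forall_mordellWeilRank_cyclotomic_le_of_kato` — **Thm. 14.4, rank form**: for `E/ℚ`
  with newform `f ∈ S₂(Γ₀(N))` and `m` prime to `N`, one bound `B` with `rank E(ℚ(ζ_M)) ≤ B` for
  every `m`-smooth level `M` (Rohrlich's finite exceptional set gives the uniform level
  `M₀ = m^{n₀}`, `sigma_primitiveCharacter_mem_of_not_exists`,
  `dvd_pow_self_of_primeFactors_subset`);
* `exists_forall_mordellWeilRank_cyclotomic_pow_le_of_kato`,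
  `exists_forall_mordellWeilRank_cyclotomic_prime_pow_le_of_kato` (`m = p ∤ N`: Mazur's question
  on the cyclotomic `ℤ_p`-tower), `exists_forall_mordellWeilRank_cyclotomic_pow_eq_of_kato`
  (the rank stabilises: `(∪_n E(ℚ(ζ_{m^n}))) ⊗ ℚ = E(ℚ(ζ_{m^{n₁}})) ⊗ ℚ`).

Not covered (`TODO(general form)`): `m` not prime to `N` ([Ro2], not in the tree); finiteness of
the torsion of `∪_n E(ℚ(ζ_{m^n}))` (Ribet 1981), which upgrades bounded rank to the printed finite
generation; abelian varieties `A` with `J₁(N) ↠ A`.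

## References

* K. Kato, *`p`-adic Hodge theory and values of zeta functions of modular forms*, Astérisque 295
  (2004), 117–290: Thm. 13.5 (2) (p. 227), Cor. 14.3 and Thm. 14.4 (pp. 235–236).
  [Kato2004Asterisque]
* D. E. Rohrlich, *On `L`-functions of elliptic curves and cyclotomic towers*, Invent. Math. 75
  (1984), 409–423, Theorem 1 and §3. [RohrlichInventiones1984]
-/

noncomputable section

open scoped BigOperators

open WeierstrassCurve WeierstrassCurve.Affine CongruenceSubgroup

namespace Literature.NumberTheory.EllipticCurves

/-! ## 1. Ranks of finitely generated abelian groups -/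

section Rank

variable {V : Type*} [AddCommGroup V]

/-- `rank(s + t) ≤ rank s + rank t` for subgroups of a finitely generated abelian group
(Mathlib `Submodule.rank_add_le_rank_add_rank` over the domain `ℤ`, in `finrank` form).
[folklore] -/
theorem finrank_int_sup_le (s t : Submodule ℤ V) [Module.Finite ℤ V] :
    Module.finrank ℤ ↥(s ⊔ t) ≤ Module.finrank ℤ s + Module.finrank ℤ t := by
  have h := Submodule.rank_add_le_rank_add_rank s t
  rw [← Module.finrank_eq_rank, ← Module.finrank_eq_rank, ← Module.finrank_eq_rank] at h
  exact_mod_cast h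

/-- `rank(∑_{i ∈ S} p i) ≤ ∑_{i ∈ S} rank(p i)` for subgroups of a finitely generated abelian
group. [folklore] -/
theorem finrank_int_biSup_le_sum [Module.Finite ℤ V] {ι : Type*} (S : Finset ι)
    (p : ι → Submodule ℤ V) :
    Module.finrank ℤ ↥(⨆ i ∈ S, p i) ≤ ∑ i ∈ S, Module.finrank ℤ ↥(p i) := by
  classical
  induction S using Finset.induction_on with
  | empty =>
    have h0 : (⨆ i ∈ (∅ : Finset ι), p i) = ⊥ := by simp
    rw [h0, finrank_bot, Finset.sum_empty]
  | insert a S ha ih =>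
    rw [Finset.iSup_insert, Finset.sum_insert ha]
    exact (finrank_int_sup_le _ _).trans (by omega)

/-- `rank(∑_i p i) ≤ ∑_i rank(p i)` over a finite index type. [folklore] -/
theorem finrank_int_iSup_le_sum [Module.Finite ℤ V] {ι : Type*} [Fintype ι]
    (p : ι → Submodule ℤ V) :
    Module.finrank ℤ ↥(⨆ i, p i) ≤ ∑ i, Module.finrank ℤ ↥(p i) := by
  have hle : (⨆ i, p i) ≤ ⨆ i ∈ (Finset.univ : Finset ι), p i :=
    iSup_le fun i => le_iSup₂_of_le (f := fun i (_ : i ∈ (Finset.univ : Finset ι)) => p i)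
      i (Finset.mem_univ i) le_rfl
  exact (Submodule.finrank_mono hle).trans (finrank_int_biSup_le_sum _ p)

/-- If a non-zero multiple `N • V` of a finitely generated abelian group `V` lies in a subgroup
`T`, then `rank V ≤ rank T` (the kernel of `N` is torsion). [folklore] -/
theorem finrank_int_le_of_smul_mem [Module.Finite ℤ V] {N : ℕ} (hN : N ≠ 0) (T : Submodule ℤ V)
    (h : ∀ x : V, N • x ∈ T) : Module.finrank ℤ V ≤ Module.finrank ℤ T := by
  set φ : V →ₗ[ℤ] V := (N : ℤ) • LinearMap.id with hφ
  have hrange : LinearMap.range φ ≤ T := by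
    rintro _ ⟨x, rfl⟩
    simpa [hφ, Nat.cast_smul_eq_nsmul] using h x
  have hker : Module.finrank ℤ ↥(LinearMap.ker φ) = 0 := by
    refine Module.finrank_eq_zero_iff.mpr fun x => ⟨(N : ℤ), by exact_mod_cast hN, ?_⟩
    apply Subtype.ext
    have hx := x.2
    rw [LinearMap.mem_ker] at hx
    simpa [hφ] using hx
  have hrn := LinearMap.rank_range_add_rank_ker φ
  rw [← Module.finrank_eq_rank, ← Module.finrank_eq_rank, ← Module.finrank_eq_rank, hker] at hrn
  norm_cast at hrn
  rw [← hrn, add_zero]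
  exact Submodule.finrank_mono hrange

/-- A finite subgroup has rank `0`. [folklore] -/
theorem finrank_int_eq_zero_of_finite (T : Submodule ℤ V) [Finite T] :
    Module.finrank ℤ T = 0 := by
  refine Module.finrank_eq_zero_iff.mpr fun x => ?_
  obtain ⟨n, hn, hnx⟩ := (isOfFinAddOrder_of_finite x).exists_nsmul_eq_zero
  exact ⟨(n : ℤ), by exact_mod_cast hn.ne', by rw [Nat.cast_smul_eq_nsmul]; exact hnx⟩

/-- The rank of a subgroup contained in the image of a homomorphism `f : V₀ → V` is at most the
rank of `V₀`. [folklore] -/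
theorem finrank_int_le_of_le_range [Module.Finite ℤ V] {V₀ : Type*} [AddCommGroup V₀]
    [Module.Finite ℤ V₀] (f : V₀ →+ V) (T : Submodule ℤ V)
    (h : ∀ x ∈ T, x ∈ f.range) : Module.finrank ℤ T ≤ Module.finrank ℤ V₀ := by
  have hle : T ≤ LinearMap.range f.toIntLinearMap := fun x hx => by
    obtain ⟨y, hy⟩ := h x hx
    exact ⟨y, hy⟩
  exact (Submodule.finrank_mono hle).trans (LinearMap.finrank_range_le _)

end Rank

/-! ## 2. `E(ℚ(ζ_M))`: exhaustion by the `χ`-parts of Dirichlet characters; descent in the tower -/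

section Tower

variable {M₀ M : ℕ} [NeZero M₀] [NeZero M]

set_option backward.isDefEq.respectTransparency false in
open scoped IsMulCommutative in
/-- **Isotypic exhaustion of `E(ℚ(ζ_M))` by the `χ`-parts of the Dirichlet characters mod `M`.**
For a Weierstrass curve `W/ℚ` and `M ≥ 1` there is `N > 0` with
`N · P ∈ ∑_{χ mod M} E(ℚ(ζ_M))^(χ)` for every `P ∈ E(ℚ(ζ_M))` (Galois action `σ ↦ Point.map σ`,
characters `cyclotomicCharacterOf χ`): the isotypic decomposition
`exists_pos_smul_mem_iSup_chiPart_complex'` for the finite abelian group `Gal(ℚ(ζ_M)/ℚ)`, all of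
whose `ℂˣ`-valued characters come from Dirichlet characters (`exists_cyclotomicCharacterOf_eq`).
[folklore] -/
theorem exists_pos_smul_mem_iSup_chiPart_dirichlet (W : WeierstrassCurve ℚ)
    [DecidableEq (CyclotomicField M ℚ)] :
    ∃ N : ℕ, 0 < N ∧ ∀ P : (W.baseChange (CyclotomicField M ℚ)).toAffine.Point,
      N • P ∈ ⨆ χ : DirichletCharacter ℂ M, chiPart
        (fun σ : CyclotomicField M ℚ ≃ₐ[ℚ] CyclotomicField M ℚ =>
          Point.map (W' := W.toAffine) (σ : CyclotomicField M ℚ →ₐ[ℚ] CyclotomicField M ℚ))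
        (fun σ => (cyclotomicCharacterOf χ σ : ℂ)) := by
  haveI : IsMulCommutative (CyclotomicField M ℚ ≃ₐ[ℚ] CyclotomicField M ℚ) :=
    IsCyclotomicExtension.isMulCommutative {M} ℚ (CyclotomicField M ℚ)
  obtain ⟨N, hN, hmem⟩ := exists_pos_smul_mem_iSup_chiPart_complex'
    (G := CyclotomicField M ℚ ≃ₐ[ℚ] CyclotomicField M ℚ)
    (fun σ => Point.map (W' := W.toAffine) (σ : CyclotomicField M ℚ →ₐ[ℚ] CyclotomicField M ℚ))
    (fun x => by cases x <;> rfl) (fun g h x => by cases x <;> rfl)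
  refine ⟨N, hN, fun P => ?_⟩
  have hle : (⨆ χ : (CyclotomicField M ℚ ≃ₐ[ℚ] CyclotomicField M ℚ) →* ℂˣ, chiPart
      (fun σ : CyclotomicField M ℚ ≃ₐ[ℚ] CyclotomicField M ℚ =>
        Point.map (W' := W.toAffine) (σ : CyclotomicField M ℚ →ₐ[ℚ] CyclotomicField M ℚ))
      (fun σ => ((χ σ : ℂˣ) : ℂ))) ≤
      ⨆ χD : DirichletCharacter ℂ M, chiPart
        (fun σ : CyclotomicField M ℚ ≃ₐ[ℚ] CyclotomicField M ℚ =>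
          Point.map (W' := W.toAffine) (σ : CyclotomicField M ℚ →ₐ[ℚ] CyclotomicField M ℚ))
        (fun σ => (cyclotomicCharacterOf χD σ : ℂ)) := by
    refine iSup_le fun χ => ?_
    obtain ⟨χD, rfl⟩ := exists_cyclotomicCharacterOf_eq χ
    exact le_iSup (fun χD : DirichletCharacter ℂ M => chiPart
      (fun σ : CyclotomicField M ℚ ≃ₐ[ℚ] CyclotomicField M ℚ =>
        Point.map (W' := W.toAffine) (σ : CyclotomicField M ℚ →ₐ[ℚ] CyclotomicField M ℚ))
      (fun σ => (cyclotomicCharacterOf χD σ : ℂ))) χD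
  exact hle (hmem P)

set_option backward.isDefEq.respectTransparency false in
/-- **Galois descent in the cyclotomic tower for inflated characters.** Let `M₀ ∣ M`,
`ι : ℚ(ζ_{M₀}) → ℚ(ζ_M)` an embedding, `χ₁` a Dirichlet character mod `M₀` and `χ = changeLevel χ₁`
its inflation mod `M`. Every point of the `χ`-part `E(ℚ(ζ_M))^(χ)` comes from `E(ℚ(ζ_{M₀}))`
(lies in the image of `Point.map ι`): for `σ ∈ Gal(ℚ(ζ_M)/ι ℚ(ζ_{M₀}))` one has `σ|_{ℚ(ζ_{M₀})} = 1`,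
so `χ(σ) = χ₁(σ|) = 1` (`cyclotomicCharacterOf_changeLevel_eq_restrictNormal`) and `σ` fixes the
`χ`-part pointwise (`apply_eq_apply_of_mem_chiPart`); the coordinates of such a point lie in the
fixed field of `Gal(ℚ(ζ_M)/ι ℚ(ζ_{M₀}))`, which is `ι ℚ(ζ_{M₀})` (Galois correspondence,
`IsGalois.fixedField_fixingSubgroup`). [folklore] -/
theorem mem_range_map_of_mem_chiPart_changeLevel (hd : M₀ ∣ M)
    (ι : CyclotomicField M₀ ℚ →ₐ[ℚ] CyclotomicField M ℚ) (W : WeierstrassCurve ℚ)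
    [DecidableEq (CyclotomicField M₀ ℚ)] [DecidableEq (CyclotomicField M ℚ)]
    (χ₁ : DirichletCharacter ℂ M₀) {P : (W.baseChange (CyclotomicField M ℚ)).toAffine.Point}
    (hP : P ∈ chiPart
      (fun σ : CyclotomicField M ℚ ≃ₐ[ℚ] CyclotomicField M ℚ =>
        Point.map (W' := W.toAffine) (σ : CyclotomicField M ℚ →ₐ[ℚ] CyclotomicField M ℚ))
      (fun σ => (cyclotomicCharacterOf (DirichletCharacter.changeLevel hd χ₁) σ : ℂ))) :
    P ∈ (Point.map (W' := W.toAffine) ι).range := by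
  letI : Algebra (CyclotomicField M₀ ℚ) (CyclotomicField M ℚ) := ι.toRingHom.toAlgebra
  haveI : IsScalarTower ℚ (CyclotomicField M₀ ℚ) (CyclotomicField M ℚ) :=
    IsScalarTower.of_algebraMap_eq fun x => (ι.commutes x).symm
  haveI : IsGalois ℚ (CyclotomicField M₀ ℚ) := IsCyclotomicExtension.isGalois {M₀} ℚ _
  haveI : IsGalois ℚ (CyclotomicField M ℚ) := IsCyclotomicExtension.isGalois {M} ℚ _
  -- Step 1: every `σ` fixing `ι ℚ(ζ_{M₀})` pointwise fixes `P`
  have hfix : ∀ σ : CyclotomicField M ℚ ≃ₐ[ℚ] CyclotomicField M ℚ,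
      (∀ z : CyclotomicField M₀ ℚ, σ (ι z) = ι z) →
      Point.map (W' := W.toAffine) (σ : CyclotomicField M ℚ →ₐ[ℚ] CyclotomicField M ℚ) P = P := by
    intro σ hσ
    have hres : σ.restrictNormal (CyclotomicField M₀ ℚ) = 1 := by
      ext z
      apply ι.injective
      exact (AlgEquiv.restrictNormal_commutes σ (CyclotomicField M₀ ℚ) z).trans (hσ z)
    have hval : (cyclotomicCharacterOf (DirichletCharacter.changeLevel hd χ₁) σ : ℂ) =
        (cyclotomicCharacterOf (DirichletCharacter.changeLevel hd χ₁) 1 : ℂ) := by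
      rw [cyclotomicCharacterOf_changeLevel_eq_restrictNormal hd ι σ χ₁, hres, map_one, map_one]
    rw [apply_eq_apply_of_mem_chiPart hP hval]
    cases P <;> rfl
  -- Step 2: the coordinates of `P` lie in `ι ℚ(ζ_{M₀})`
  rcases P with _ | ⟨x, y, h⟩
  · exact ⟨0, rfl⟩
  · have hxy : ∀ σ ∈ ι.fieldRange.fixingSubgroup, σ x = x ∧ σ y = y := by
      intro σ hσ
      have hσ' : ∀ z : CyclotomicField M₀ ℚ, σ (ι z) = ι z := fun z =>
        (IntermediateField.mem_fixingSubgroup_iff _ _).mp hσ (ι z) (ι.mem_fieldRange.mpr ⟨z, rfl⟩)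
      have := hfix σ hσ'
      rw [Point.map_some] at this
      exact Point.some.inj this
    have hx : x ∈ IntermediateField.fixedField ι.fieldRange.fixingSubgroup :=
      (IntermediateField.mem_fixedField_iff _ _).mpr fun σ hσ => (hxy σ hσ).1
    have hy : y ∈ IntermediateField.fixedField ι.fieldRange.fixingSubgroup :=
      (IntermediateField.mem_fixedField_iff _ _).mpr fun σ hσ => (hxy σ hσ).2
    rw [IsGalois.fixedField_fixingSubgroup] at hx hy
    obtain ⟨a, rfl⟩ := ι.mem_fieldRange.mp hx
    obtain ⟨b, rfl⟩ := ι.mem_fieldRange.mp hy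
    exact ⟨.some a b ((WeierstrassCurve.Affine.baseChange_nonsingular (W := W.toAffine) (f := ι)
      ι.injective a b).mp h), rfl⟩

end Tower

/-! ## 3. Exceptional characters: Rohrlich's finite set and a uniform level -/

section Exceptional

open ModularForms

/-- A number `k ≥ 1` all of whose prime factors divide `m` divides `m ^ k` (`v_p(k) < k ≤ k v_p(m)`
at every prime `p ∣ k`). [folklore] -/
theorem dvd_pow_self_of_primeFactors_subset {k m : ℕ} (hk : k ≠ 0) (hm : m ≠ 0)
    (h : k.primeFactors ⊆ m.primeFactors) : k ∣ m ^ k := by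
  rw [← Nat.factorization_le_iff_dvd hk (pow_ne_zero _ hm), Nat.factorization_pow]
  intro p
  rw [Finsupp.smul_apply, smul_eq_mul]
  by_cases hp : p ∈ k.primeFactors
  · have hpm : 1 ≤ m.factorization p := by
      have := h hp
      rw [Nat.mem_primeFactors] at this
      exact this.1.factorization_pos_of_dvd hm this.2.1
    calc k.factorization p ≤ k := (Nat.factorization_lt p hk).le
      _ = k * 1 := (mul_one k).symm
      _ ≤ k * m.factorization p := Nat.mul_le_mul_left k hpm
  · rw [← Nat.support_factorization, Finsupp.notMem_support_iff] at hp
    rw [hp]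
    exact Nat.zero_le _

variable {N : ℕ} [NeZero N]

/-- **Exceptional characters have exceptional primitive characters.** For the newform `f` of an
elliptic curve `E/ℚ` and a Dirichlet character `χ` mod `M`: if the mod-`M` twisted series
`∑ χ(n) aₙ n⁻ˢ` has NO entire continuation non-vanishing at `s = 1` (Kato's hypothesis fails), then
the entire continuation of the primitive twist `L(f ⊗ χ₀, s)`, `χ₀ = χ.primitiveCharacter` — which
exists, `exists_differentiable_eq_twistedLSeries_holds` — vanishes at `1`
(`exists_continuation_iff_primitive`: the two differ by finitely many Euler factors non-zero at
`1`). [folklore] -/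
theorem exists_continuation_primitive_eq_zero_of_not_exists {W : WeierstrassCurve ℚ}
    [W.IsElliptic] {f : CuspForm (Gamma0 N) 2} (hf : IsNewformOf W f) {M : ℕ} [NeZero M]
    (χ : DirichletCharacter ℂ M)
    (hχ : ¬ ∃ L : ℂ → ℂ, Differentiable ℂ L ∧
      (∀ s : ℂ, 2 < s.re → L s = twistedLSeries f χ s) ∧ L 1 ≠ 0) :
    ∃ L₀ : ℂ → ℂ, Differentiable ℂ L₀ ∧
      (∀ s : ℂ, 2 < s.re → L₀ s = twistedLSeries f χ.primitiveCharacter s) ∧ L₀ 1 = 0 := by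
  haveI : NeZero χ.conductor := ⟨χ.conductor_ne_zero⟩
  obtain ⟨L₀, hd, hs⟩ := exists_differentiable_eq_twistedLSeries_holds f χ.primitiveCharacter
  refine ⟨L₀, hd, hs, ?_⟩
  by_contra h1
  exact hχ ((exists_continuation_iff_primitive hf χ).mpr ⟨L₀, hd, hs, h1⟩)

/-- **The exceptional characters of an `m`-smooth level sit in Rohrlich's finite set.** For the
newform `f` of `E/ℚ`, `m ≥ 1`, a level `M` whose prime factors divide `m`, and a Dirichlet
character `χ` mod `M` failing Kato's hypothesis, the pair `(cond χ, χ₀)` belongs to the set of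
primitive characters of conductor supported on `prime(m)` with `L(1, f ⊗ χ₀) = 0` — the set that
Rohrlich's theorem `Rohrlich1984_nonvanishing_twists` (P = prime(m)) asserts to be finite.
[folklore] -/
theorem sigma_primitiveCharacter_mem_of_not_exists {W : WeierstrassCurve ℚ} [W.IsElliptic]
    {f : CuspForm (Gamma0 N) 2} (hf : IsNewformOf W f) {m M : ℕ} [NeZero m] [NeZero M]
    (hM : M.primeFactors ⊆ m.primeFactors) (χ : DirichletCharacter ℂ M)
    (hχ : ¬ ∃ L : ℂ → ℂ, Differentiable ℂ L ∧
      (∀ s : ℂ, 2 < s.re → L s = twistedLSeries f χ s) ∧ L 1 ≠ 0) :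
    (⟨χ.conductor, χ.primitiveCharacter⟩ : Σ k : ℕ, DirichletCharacter ℂ k) ∈
      {ψ : Σ k : ℕ, DirichletCharacter ℂ k |
        ψ.1 ≠ 0 ∧ ψ.1.primeFactors ⊆ m.primeFactors ∧ ψ.2.IsPrimitive ∧
          ∃ L : ℂ → ℂ, Differentiable ℂ L ∧
            (∀ s : ℂ, 2 < s.re → L s = twistedLSeries f ψ.2 s) ∧ L 1 = 0} :=
  ⟨χ.conductor_ne_zero,
    (Nat.primeFactors_mono χ.conductor_dvd_level (NeZero.ne M)).trans hM,
    χ.primitiveCharacter_isPrimitive,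
    exists_continuation_primitive_eq_zero_of_not_exists hf χ hχ⟩

/-- **Inflation from the uniform level.** If `cond χ ∣ M₀ ∣ M` then `χ` mod `M` is the inflation
of the character `changeLevel (cond χ ∣ M₀) χ₀` mod `M₀` (Mathlib `changeLevel_primitiveCharacter`,
`changeLevel_trans`). [folklore] -/
theorem eq_changeLevel_changeLevel_primitiveCharacter {M₀ M : ℕ} (χ : DirichletCharacter ℂ M)
    (hc : χ.conductor ∣ M₀) (hd : M₀ ∣ M) :
    χ = DirichletCharacter.changeLevel hd
      (DirichletCharacter.changeLevel hc χ.primitiveCharacter) := by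
  rw [← DirichletCharacter.changeLevel_trans]
  exact (DirichletCharacter.changeLevel_primitiveCharacter χ).symm

end Exceptional

/-! ## 4. Kato's Thm. 14.4, rank form: bounded Mordell–Weil rank in the tower `ℚ(ζ_{m^n})` -/

section Assembly

open ModularForms

set_option backward.isDefEq.respectTransparency false in
open scoped Classical in
/-- **The rank of `E(ℚ(ζ_M))` is controlled by a level `M₀ ∣ M` carrying all exceptional
conductors** (the engine of Kato's Thm. 14.4). Assume the vendored fact
`kato_finite_chiPart_of_twistedLValue_ne_zero` (Kato, Astérisque 295, Cor. 14.3 (2); hypothesis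
`hK`, NOT proved in the tree). Let `E/ℚ` be an elliptic curve with newform `f`, `M₀ ∣ M`, and
suppose every Dirichlet character `χ` mod `M` FAILING Kato's hypothesis (no entire continuation of
`∑ χ(n) aₙ n⁻ˢ` non-vanishing at `1`) has conductor dividing `M₀`. Then
`rank E(ℚ(ζ_M)) ≤ #{χ mod M₀} · rank E(ℚ(ζ_{M₀}))`: a non-zero multiple of `E(ℚ(ζ_M))` lies in
`∑_χ E(ℚ(ζ_M))^(χ)` (`exists_pos_smul_mem_iSup_chiPart_dirichlet`), the `χ`-parts of the
non-exceptional `χ` are finite (Kato), and each exceptional `χ` is inflated from level `M₀`, so its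
`χ`-part comes from `E(ℚ(ζ_{M₀}))` (`mem_range_map_of_mem_chiPart_changeLevel`); there are at most
`#{χ mod M₀}` of them. [cite: Kato2004Asterisque, Thm. 14.4 (p. 236)] -/
theorem finrank_point_cyclotomic_le_of_kato
    (hK : kato_finite_chiPart_of_twistedLValue_ne_zero)
    (W : WeierstrassCurve ℚ) [W.IsElliptic] {N : ℕ} [NeZero N] {f : CuspForm (Gamma0 N) 2}
    (hf : IsNewformOf W f) {M₀ M : ℕ} [NeZero M₀] [NeZero M] (hd : M₀ ∣ M)
    (hexc : ∀ χ : DirichletCharacter ℂ M,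
      (¬ ∃ L : ℂ → ℂ, Differentiable ℂ L ∧
        (∀ s : ℂ, 2 < s.re → L s = twistedLSeries f χ s) ∧ L 1 ≠ 0) → χ.conductor ∣ M₀) :
    Module.finrank ℤ (W.baseChange (CyclotomicField M ℚ)).toAffine.Point ≤
      Nat.card (DirichletCharacter ℂ M₀) *
        Module.finrank ℤ (W.baseChange (CyclotomicField M₀ ℚ)).toAffine.Point := by
  classical
  haveI : (W.baseChange (CyclotomicField M ℚ)).IsElliptic := by
    rw [WeierstrassCurve.baseChange]; infer_instance
  haveI : (W.baseChange (CyclotomicField M₀ ℚ)).IsElliptic := by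
    rw [WeierstrassCurve.baseChange]; infer_instance
  haveI : Module.Finite ℤ (W.baseChange (CyclotomicField M ℚ)).toAffine.Point :=
    (W.baseChange (CyclotomicField M ℚ)).module_finite_point_holds
  haveI : Module.Finite ℤ (W.baseChange (CyclotomicField M₀ ℚ)).toAffine.Point :=
    (W.baseChange (CyclotomicField M₀ ℚ)).module_finite_point_holds
  letI : Fintype (DirichletCharacter ℂ M₀) := Fintype.ofFinite _
  letI : Fintype (DirichletCharacter ℂ M) := Fintype.ofFinite _
  obtain ⟨ι⟩ := nonempty_algHom_cyclotomicField_of_dvd hd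
  -- the `χ`-parts, as subgroups (`ℤ`-submodules) of `E(ℚ(ζ_M))`
  set C : DirichletCharacter ℂ M →
      Submodule ℤ (W.baseChange (CyclotomicField M ℚ)).toAffine.Point := fun χ => (chiPart
        (fun σ : CyclotomicField M ℚ ≃ₐ[ℚ] CyclotomicField M ℚ =>
          Point.map (W' := W.toAffine) (σ : CyclotomicField M ℚ →ₐ[ℚ] CyclotomicField M ℚ))
        (fun σ => (cyclotomicCharacterOf χ σ : ℂ))).toIntSubmodule with hC
  set r₀ : ℕ := Module.finrank ℤ (W.baseChange (CyclotomicField M₀ ℚ)).toAffine.Point with hr₀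
  set I : Finset (DirichletCharacter ℂ M) :=
    Finset.univ.image (DirichletCharacter.changeLevel hd) with hI
  -- (1) isotypic exhaustion: `rank E(ℚ(ζ_M)) ≤ ∑_χ rank E(ℚ(ζ_M))^(χ)`
  obtain ⟨Nn, hNn, hmem⟩ := exists_pos_smul_mem_iSup_chiPart_dirichlet (M := M) W
  have h1 : Module.finrank ℤ (W.baseChange (CyclotomicField M ℚ)).toAffine.Point ≤
      ∑ χ, Module.finrank ℤ ↥(C χ) := by
    refine (finrank_int_le_of_smul_mem hNn.ne' (⨆ χ, C χ) fun P => ?_).trans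
      (finrank_int_iSup_le_sum C)
    have hmap : (⨆ χ : DirichletCharacter ℂ M, chiPart
        (fun σ : CyclotomicField M ℚ ≃ₐ[ℚ] CyclotomicField M ℚ =>
          Point.map (W' := W.toAffine) (σ : CyclotomicField M ℚ →ₐ[ℚ] CyclotomicField M ℚ))
        (fun σ => (cyclotomicCharacterOf χ σ : ℂ))).toIntSubmodule = ⨆ χ, C χ :=
      OrderIso.map_iSup AddSubgroup.toIntSubmodule _
    rw [← hmap]
    exact hmem P
  -- (2) per character: exceptional `χ` come from level `M₀`, the others have finite `χ`-part
  have h2 : ∀ χ : DirichletCharacter ℂ M,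
      Module.finrank ℤ ↥(C χ) ≤ if χ ∈ I then r₀ else 0 := by
    intro χ
    split_ifs with hχ
    · obtain ⟨χ₁, -, rfl⟩ := Finset.mem_image.mp hχ
      exact finrank_int_le_of_le_range (Point.map (W' := W.toAffine) ι) (C _) fun P hP =>
        mem_range_map_of_mem_chiPart_changeLevel hd ι W χ₁ hP
    · have hL : ∃ L : ℂ → ℂ, Differentiable ℂ L ∧
          (∀ s : ℂ, 2 < s.re → L s = twistedLSeries f χ s) ∧ L 1 ≠ 0 := by
        by_contra hno
        exact hχ (Finset.mem_image.mpr ⟨_, Finset.mem_univ _,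
          (eq_changeLevel_changeLevel_primitiveCharacter χ (hexc χ hno) hd).symm⟩)
      haveI : Finite ↥(C χ) :=
        kato_finite_chiPart_cyclotomic_of_twistedLValue_ne_zero_of hK W hf χ hL
      rw [finrank_int_eq_zero_of_finite]
  -- (3) count
  calc Module.finrank ℤ (W.baseChange (CyclotomicField M ℚ)).toAffine.Point
      ≤ ∑ χ, Module.finrank ℤ ↥(C χ) := h1
    _ ≤ ∑ χ, (if χ ∈ I then r₀ else 0) := Finset.sum_le_sum fun χ _ => h2 χ
    _ = I.card * r₀ := by
        rw [Finset.sum_ite_mem, Finset.univ_inter, Finset.sum_const, smul_eq_mul]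
    _ ≤ Fintype.card (DirichletCharacter ℂ M₀) * r₀ :=
        Nat.mul_le_mul_right _ Finset.card_image_le
    _ = Nat.card (DirichletCharacter ℂ M₀) * r₀ := by rw [Nat.card_eq_fintype_card]

set_option backward.isDefEq.respectTransparency false in
open scoped Classical in
/-- **The Mordell–Weil rank grows along `ℚ(ζ_M) ⊂ ℚ(ζ_{M'})`, `M ∣ M'`**: an embedding
`ι : ℚ(ζ_M) → ℚ(ζ_{M'})` (`nonempty_algHom_cyclotomicField_of_dvd`) induces an injective
homomorphism `Point.map ι : E(ℚ(ζ_M)) → E(ℚ(ζ_{M'}))` of finitely generated abelian groups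
(Mordell–Weil, `module_finite_point_holds`). [folklore] -/
theorem finrank_point_cyclotomic_mono (W : WeierstrassCurve ℚ) [W.IsElliptic] {M M' : ℕ}
    [NeZero M] [NeZero M'] (hd : M ∣ M') :
    Module.finrank ℤ (W.baseChange (CyclotomicField M ℚ)).toAffine.Point ≤
      Module.finrank ℤ (W.baseChange (CyclotomicField M' ℚ)).toAffine.Point := by
  obtain ⟨ι⟩ := nonempty_algHom_cyclotomicField_of_dvd hd
  haveI : (W.baseChange (CyclotomicField M' ℚ)).IsElliptic := by
    rw [WeierstrassCurve.baseChange]; infer_instance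
  haveI : Module.Finite ℤ (W.baseChange (CyclotomicField M' ℚ)).toAffine.Point :=
    (W.baseChange (CyclotomicField M' ℚ)).module_finite_point_holds
  exact LinearMap.finrank_le_finrank_of_injective
    (f := (Point.map (W' := W.toAffine) ι).toIntLinearMap) (Point.map_injective ι)

open scoped Classical in
/-- **Kato's Thm. 14.4 (Astérisque 295, p. 236), rank form: the Mordell–Weil rank of `E` over the
`m`-smooth cyclotomic fields `ℚ(ζ_M)`, `prime(M) ⊆ prime(m)` — whose union is
`ℚ(ζ_{m^∞}) = ∪_n ℚ(ζ_{m^n})` — is bounded**, GIVEN the vendored Cor. 14.3 (2)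
(`kato_finite_chiPart_of_twistedLValue_ne_zero`, hypothesis `hK`, NOT proved in the tree); the
other inputs of the printed deduction, Rohrlich's non-vanishing theorem
(`Rohrlich1984_nonvanishing_twists_holds`) and the Mordell–Weil theorem
(`WeierstrassCurve.module_finite_point_holds`), ARE theorems of the tree. As printed (p. 236):
"I learned from Professor John Coates that the following result is deduced from Cor. 14.3 by
using the theorem of Rohrlich introduced in 13.5 (2). **Theorem 14.4.** Let `A` be an abelian
variety over `ℚ` such that there is a surjective homomorphism `J₁(N) → A` for some `N ≥ 1`. Then
for any `m ≥ 1`, `∪_n A(ℚ(ζ_{m^n}))` is finitely generated as an abelian group. The argument to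
deduce 14.4 from 14.2 is given in Rohrlich [Ro1, §3]" — [Ro1] = Rohrlich, Invent. Math. 75 (1984);
Thm. 13.5 (2) (p. 227) is Rohrlich's finiteness of the set of characters `χ` of `m`-smooth
conductor with `L_S(f, χ, k/2) = 0`, quoted there from [Ro2] = Math. Ann. 281 (1988). HERE:
`A = E` is an elliptic curve over `ℚ` with newform `f ∈ S₂(Γ₀(N))` (`IsNewformOf W f`); `m ≥ 1` is
prime to `N` (the tree's Rohrlich theorem is [Ro1], Theorem 1, for sets of primes not dividing the
level, `P = prime(m)`); and the conclusion is the RANK part of finite generation — one bound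
`B` with `rank_ℤ E(ℚ(ζ_M)) ≤ B` for every `m`-smooth `M`, i.e. `(∪_M E(ℚ(ζ_M))) ⊗ ℚ` is finite
dimensional. Proof (Kato p. 236 / Rohrlich 1984 §3): Rohrlich's finite set `S` of primitive `χ₀`
of `m`-smooth conductor with `L(f ⊗ χ₀, 1) = 0` gives a level `M₀ = m^{n₀}` divisible by all
their conductors (`dvd_pow_self_of_primeFactors_subset`); a character `χ` of `m`-smooth level
failing Kato's hypothesis has `(cond χ, χ₀) ∈ S` (`sigma_primitiveCharacter_mem_of_not_exists`:
imprimitive and primitive twisted `L`-values vanish together, `exists_continuation_iff_primitive`),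
so `cond χ ∣ M₀`; hence `rank E(ℚ(ζ_M)) ≤ rank E(ℚ(ζ_{M M₀})) ≤ #{χ mod M₀} · rank E(ℚ(ζ_{M₀}))`
(`finrank_point_cyclotomic_mono`, `finrank_point_cyclotomic_le_of_kato`).
-- TODO(general form): `m` not prime to `N` ([Ro2]: Rohrlich, Math. Ann. 281 (1988), not in the
-- tree); finiteness of the torsion of `∪_n E(ℚ(ζ_{m^n}))` (Ribet 1981), which upgrades bounded
-- rank to the printed finite generation; abelian varieties `A` with `J₁(N) ↠ A`.
[cite: Kato2004Asterisque, Thm. 14.4 (p. 236)] -/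
theorem exists_forall_mordellWeilRank_cyclotomic_le_of_kato
    (hK : kato_finite_chiPart_of_twistedLValue_ne_zero)
    (W : WeierstrassCurve ℚ) [W.IsElliptic] {N : ℕ} [NeZero N] {f : CuspForm (Gamma0 N) 2}
    (hf : IsNewformOf W f) (m : ℕ) [NeZero m] (hmN : ∀ q ∈ m.primeFactors, ¬ q ∣ N) :
    ∃ B : ℕ, ∀ (M : ℕ) [NeZero M], M.primeFactors ⊆ m.primeFactors →
      (W.baseChange (CyclotomicField M ℚ)).mordellWeilRank ≤ B := by
  -- Rohrlich's finite exceptional set for `P = prime(m)` and the uniform level `m ^ n₀`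
  have hS := Rohrlich1984_nonvanishing_twists_holds hf.1 m.primeFactors hmN
  set n₀ : ℕ := hS.toFinset.sup Sigma.fst with hn₀
  have hexc : ∀ (M : ℕ) [NeZero M], M.primeFactors ⊆ m.primeFactors →
      ∀ χ : DirichletCharacter ℂ M,
        (¬ ∃ L : ℂ → ℂ, Differentiable ℂ L ∧
          (∀ s : ℂ, 2 < s.re → L s = twistedLSeries f χ s) ∧ L 1 ≠ 0) →
        χ.conductor ∣ m ^ n₀ := by
    intro M _ hM χ hχ
    have hmem := sigma_primitiveCharacter_mem_of_not_exists hf hM χ hχ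
    have hle : χ.conductor ≤ n₀ := Finset.le_sup (f := Sigma.fst) (hS.mem_toFinset.mpr hmem)
    exact (dvd_pow_self_of_primeFactors_subset χ.conductor_ne_zero (NeZero.ne m) hmem.2.1).trans
      (pow_dvd_pow m hle)
  refine ⟨Nat.card (DirichletCharacter ℂ (m ^ n₀)) *
      (W.baseChange (CyclotomicField (m ^ n₀) ℚ)).mordellWeilRank, fun M _ hM => ?_⟩
  haveI : NeZero (M * m ^ n₀) := ⟨mul_ne_zero (NeZero.ne M) (pow_ne_zero _ (NeZero.ne m))⟩
  have hM' : (M * m ^ n₀).primeFactors ⊆ m.primeFactors := by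
    rw [Nat.primeFactors_mul (NeZero.ne M) (pow_ne_zero _ (NeZero.ne m))]
    refine Finset.union_subset hM ?_
    rcases Nat.eq_zero_or_pos n₀ with h0 | h0
    · rw [h0, pow_zero, Nat.primeFactors_one]; exact Finset.empty_subset _
    · rw [Nat.primeFactors_pow m h0.ne']
  exact (finrank_point_cyclotomic_mono W (dvd_mul_right M (m ^ n₀))).trans
    (finrank_point_cyclotomic_le_of_kato hK W hf (M₀ := m ^ n₀) (M := M * m ^ n₀)
      (dvd_mul_left (m ^ n₀) M) (hexc (M * m ^ n₀) hM'))

open scoped Classical in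
/-- **Kato's Thm. 14.4, rank form, in the tower `ℚ(ζ_{m^n})`** (the printed indexing): for an
elliptic curve `E/ℚ` with newform `f ∈ S₂(Γ₀(N))`, `m ≥ 1` prime to `N`, and GIVEN the vendored
Cor. 14.3 (2) (`hK`), the Mordell–Weil ranks `rank_ℤ E(ℚ(ζ_{m^n}))`, `n ≥ 0`, are bounded
(`exists_forall_mordellWeilRank_cyclotomic_le_of_kato` at the `m`-smooth levels `m^n`).
[cite: Kato2004Asterisque, Thm. 14.4 (p. 236)] -/
theorem exists_forall_mordellWeilRank_cyclotomic_pow_le_of_kato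
    (hK : kato_finite_chiPart_of_twistedLValue_ne_zero)
    (W : WeierstrassCurve ℚ) [W.IsElliptic] {N : ℕ} [NeZero N] {f : CuspForm (Gamma0 N) 2}
    (hf : IsNewformOf W f) (m : ℕ) [NeZero m] (hmN : ∀ q ∈ m.primeFactors, ¬ q ∣ N) :
    ∃ B : ℕ, ∀ n : ℕ, (W.baseChange (CyclotomicField (m ^ n) ℚ)).mordellWeilRank ≤ B := by
  obtain ⟨B, hB⟩ := exists_forall_mordellWeilRank_cyclotomic_le_of_kato hK W hf m hmN
  refine ⟨B, fun n => hB (m ^ n) ?_⟩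
  -- `prime(m ^ n) ⊆ prime(m)` (cf. `BugeaudCorvajaZannier2003.primeFactors_pow_subset`)
  rcases Nat.eq_zero_or_pos n with rfl | hn
  · rw [pow_zero, Nat.primeFactors_one]; exact Finset.empty_subset _
  · rw [Nat.primeFactors_pow m hn.ne']

open scoped Classical in
/-- **Mazur's question for the cyclotomic `ℤ_p`-tower, after Kato–Rohrlich** (the case `m = p`
of Kato's Thm. 14.4, rank form): for an elliptic curve `E/ℚ` with newform `f ∈ S₂(Γ₀(N))` and a
prime `p ∤ N`, the ranks `rank_ℤ E(ℚ(ζ_{p^n}))`, `n ≥ 0` — hence the ranks of `E` over the layers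
`ℚ_n ⊂ ℚ(ζ_{p^{n+1}})` of the cyclotomic `ℤ_p`-extension — are bounded, GIVEN the vendored
Cor. 14.3 (2) (`hK`); Rohrlich's theorem and Mordell–Weil are theorems of the tree.
[cite: Kato2004Asterisque, Thm. 14.4 (p. 236)] -/
theorem exists_forall_mordellWeilRank_cyclotomic_prime_pow_le_of_kato
    (hK : kato_finite_chiPart_of_twistedLValue_ne_zero)
    (W : WeierstrassCurve ℚ) [W.IsElliptic] {N : ℕ} [NeZero N] {f : CuspForm (Gamma0 N) 2}
    (hf : IsNewformOf W f) {p : ℕ} (hp : p.Prime) (hpN : ¬ p ∣ N) :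
    ∃ B : ℕ, ∀ n : ℕ, (W.baseChange (CyclotomicField (p ^ n) ℚ)).mordellWeilRank ≤ B := by
  haveI : NeZero p := ⟨hp.ne_zero⟩
  refine exists_forall_mordellWeilRank_cyclotomic_pow_le_of_kato hK W hf p fun q hq => ?_
  rw [hp.primeFactors, Finset.mem_singleton] at hq
  rw [hq]
  exact hpN

open scoped Classical in
/-- **The rank stabilises in the tower `ℚ(ζ_{m^n})`** (Kato's Thm. 14.4, rank form, as
`(∪_n E(ℚ(ζ_{m^n}))) ⊗ ℚ = E(ℚ(ζ_{m^{n₁}})) ⊗ ℚ`): for `E/ℚ` with newform `f ∈ S₂(Γ₀(N))`, `m ≥ 1`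
prime to `N`, and GIVEN the vendored Cor. 14.3 (2) (`hK`), there is `n₁` with
`rank_ℤ E(ℚ(ζ_{m^n})) = rank_ℤ E(ℚ(ζ_{m^{n₁}}))` for all `n ≥ n₁` — the ranks increase along the
tower (`finrank_point_cyclotomic_mono`) and are bounded
(`exists_forall_mordellWeilRank_cyclotomic_pow_le_of_kato`).
[cite: Kato2004Asterisque, Thm. 14.4 (p. 236)] -/
theorem exists_forall_mordellWeilRank_cyclotomic_pow_eq_of_kato
    (hK : kato_finite_chiPart_of_twistedLValue_ne_zero)
    (W : WeierstrassCurve ℚ) [W.IsElliptic] {N : ℕ} [NeZero N] {f : CuspForm (Gamma0 N) 2}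
    (hf : IsNewformOf W f) (m : ℕ) [NeZero m] (hmN : ∀ q ∈ m.primeFactors, ¬ q ∣ N) :
    ∃ n₁ : ℕ, ∀ n : ℕ, n₁ ≤ n →
      (W.baseChange (CyclotomicField (m ^ n) ℚ)).mordellWeilRank =
        (W.baseChange (CyclotomicField (m ^ n₁) ℚ)).mordellWeilRank := by
  obtain ⟨B, hB⟩ := exists_forall_mordellWeilRank_cyclotomic_pow_le_of_kato hK W hf m hmN
  set r : ℕ → ℕ := fun n => (W.baseChange (CyclotomicField (m ^ n) ℚ)).mordellWeilRank with hr
  have hbdd : BddAbove (Set.range r) := ⟨B, by rintro _ ⟨n, rfl⟩; exact hB n⟩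
  obtain ⟨n₁, hn₁⟩ : sSup (Set.range r) ∈ Set.range r := Nat.sSup_mem (Set.range_nonempty r) hbdd
  refine ⟨n₁, fun n hn => le_antisymm ?_ ?_⟩
  · change r n ≤ r n₁
    rw [hn₁]
    exact le_csSup hbdd ⟨n, rfl⟩
  · exact finrank_point_cyclotomic_mono W (pow_dvd_pow m hn)

end Assembly

end Literature.NumberTheory.EllipticCurves

end
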